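import Summits.QuantumAdvantage.AdviceFreeQNC0.LinearSelections
import HarnessLib

/-!
# JLinDegree — junta ⊕ one-linear-form selections have `𝔽_p`-degree `≤ |J| + (p − 1)`

(decomp-qadv-lens-6 g8, CharDial rev 2, the W-edge the critic noted as "edge not kernel": row 47.)

`hasDegF_jlin`: if a cut is `y(u) = h(u|_J, Σ aᵢuᵢ mod p)` with `h` determined by the bits in `J`, then
`HasDegF p y (J.card + (p - 1))` — the indicator is `Σ_w Σ_r [h w r] · 1_{u|_J = w} · [Σ aᵢuᵢ = r]`, a sum of
products of `|J|` literals (degree 1 each) with one MOD_p test of a linear form (degree `p − 1`,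
tree `hasDegF_linTest`).

`walkHardF_jlin`: hence `WalkHardF p` implies hardness against junta(`≤ log₂ n`) ⊕ one-form players
(the node's `WalkHardFJLin p`, spelled out): with `C = 2` and `n ≥ 2^p`, `log₂ n + p − 1 ≤ (log₂ n)²`.
-/

namespace Summit.QuantumAdvantage.AdviceFreeQNC0

open Classical
open Finset
open Literature.Computability.MetaComplexity Literature.Computability.MetaComplexity.Smolensky

variable {p : ℕ} [Fact p.Prime] {n : ℕ}

namespace JLin

/-- A product over `S` of functions of degree `≤ 1` has degree `≤ |S|`. -/
theorem prod_mem_lowDeg_one {ι : Type*} (S : Finset ι) (f : ι → CubeFn (ZMod p) n)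
    (hf : ∀ i ∈ S, f i ∈ lowDeg (ZMod p) n 1) : (∏ i ∈ S, f i) ∈ lowDeg (ZMod p) n S.card := by
  induction S using Finset.induction_on with
  | empty => rw [prod_empty, card_empty]; exact one_mem_lowDeg 0
  | insert a S ha ih =>
    rw [prod_insert ha, card_insert_of_notMem ha, add_comm]
    exact mul_mem_lowDeg_add (hf a (mem_insert_self a S)) (ih fun i hi => hf i (mem_insert_of_mem hi))

/-- The literal `[u i = b]` has degree `≤ 1`. -/
theorem literal_mem_lowDeg (i : Fin n) (b : Bool) :
    (fun u : Fin n → Bool => if u i = b then (1 : ZMod p) else 0) ∈ lowDeg (ZMod p) n 1 := by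
  cases b with
  | true =>
    have : (fun u : Fin n → Bool => if u i = true then (1 : ZMod p) else 0)
        = fun u : Fin n → Bool => if u i then (1 : ZMod p) else 0 := by
      funext u; cases u i <;> simp
    rw [this]; exact bitFn_mem_lowDeg i le_rfl
  | false =>
    have : (fun u : Fin n → Bool => if u i = false then (1 : ZMod p) else 0)
        = 1 - fun u : Fin n → Bool => if u i then (1 : ZMod p) else 0 := by
      funext u; simp only [Pi.sub_apply, Pi.one_apply]; cases u i <;> simp
    rw [this]; exact Submodule.sub_mem _ (one_mem_lowDeg 1) (bitFn_mem_lowDeg i le_rfl)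

/-- The pattern indicator `1_{u|_J = w|_J}` has degree `≤ |J|`. -/
theorem pattern_mem_lowDeg (J : Finset (Fin n)) (w : Fin n → Bool) :
    (fun u : Fin n → Bool => if (∀ i ∈ J, u i = w i) then (1 : ZMod p) else 0) ∈ lowDeg (ZMod p) n J.card := by
  have heq : (fun u : Fin n → Bool => if (∀ i ∈ J, u i = w i) then (1 : ZMod p) else 0)
      = ∏ i ∈ J, fun u : Fin n → Bool => if u i = w i then (1 : ZMod p) else 0 := by
    funext u
    rw [Finset.prod_apply]
    by_cases h : ∀ i ∈ J, u i = w i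
    · rw [if_pos h]; exact (Finset.prod_eq_one fun i hi => by simp [h i hi]).symm
    · rw [if_neg h]; push Not at h; obtain ⟨i, hi, hne⟩ := h
      exact (Finset.prod_eq_zero hi (by simp [hne])).symm
  rw [heq]
  exact prod_mem_lowDeg_one J _ fun i _ => literal_mem_lowDeg i (w i)

/-- The linear form of a coefficient vector. -/
def form (a : Fin n → ZMod p) (u : Fin n → Bool) : ZMod p := ∑ i, if u i then a i else 0

/-- The projection of `u` onto the pattern supported in `J`. -/
def proj (J : Finset (Fin n)) (u : Fin n → Bool) : Fin n → Bool := fun i => if i ∈ J then u i else false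

/-- CharDial sub-characteristic helper `proj_agree` (lens-6 g8 LAND package; see the module docstring). -/
theorem proj_agree (J : Finset (Fin n)) (u : Fin n → Bool) : ∀ i ∈ J, proj J u i = u i := by
  intro i hi; simp [proj, hi]

end JLin

open JLin

/-- **Junta ⊕ one-form cuts have degree `≤ |J| + (p − 1)`.** -/
theorem hasDegF_jlin (J : Finset (Fin n)) (a : Fin n → ZMod p) (h : (Fin n → Bool) → ZMod p → Bool)
    (hJ : ∀ u v : Fin n → Bool, (∀ i ∈ J, u i = v i) → ∀ s, h u s = h v s)
    (y : (Fin n → Bool) → Bool) (hy : ∀ u, y u = h u (∑ i, if u i then a i else 0)) :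
    HasDegF p y (J.card + (p - 1)) := by
  unfold HasDegF
  -- the pattern set: Boolean vectors supported inside J
  set W : Finset (Fin n → Bool) := univ.filter fun w => ∀ i, i ∉ J → w i = false with hW
  have key : (fun u : Fin n → Bool => if y u = true then (1 : ZMod p) else 0)
      = ∑ w ∈ W, ∑ r : ZMod p, (if h w r = true then (1 : ZMod p) else 0) •
          ((fun u : Fin n → Bool => if (∀ i ∈ J, u i = w i) then (1 : ZMod p) else 0) *
           (fun u : Fin n → Bool => if decide (form a u = r) = true then (1 : ZMod p) else 0)) := by
    funext u
    simp only [Finset.sum_apply, Pi.smul_apply, Pi.mul_apply, smul_eq_mul, decide_eq_true_eq]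
    -- inner sum over r collapses to r = form a u
    have inner : ∀ w : Fin n → Bool,
        ∑ r : ZMod p, (if h w r = true then (1 : ZMod p) else 0) *
          ((if (∀ i ∈ J, u i = w i) then (1 : ZMod p) else 0) * (if form a u = r then (1 : ZMod p) else 0))
        = (if h w (form a u) = true then (1 : ZMod p) else 0) * (if (∀ i ∈ J, u i = w i) then (1 : ZMod p) else 0) := by
      intro w
      rw [Finset.sum_eq_single (form a u)]
      · simp
      · intro r _ hr; rw [if_neg (Ne.symm hr)]; simp
      · intro hnot; exact absurd (Finset.mem_univ _) hnot
    rw [Finset.sum_congr rfl fun w _ => inner w]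
    -- outer sum over w collapses to w = proj J u
    have hmem : proj J u ∈ W := by
      rw [hW]; simp only [mem_filter, mem_univ, true_and]; intro i hi; simp [proj, hi]
    rw [Finset.sum_eq_single (proj J u)]
    · have hag : ∀ i ∈ J, u i = proj J u i := fun i hi => (proj_agree J u i hi).symm
      rw [if_pos hag, mul_one, hy u, hJ u (proj J u) (fun i hi => (proj_agree J u i hi).symm)]
      rfl
    · intro w hw hne
      have hdis : ¬ (∀ i ∈ J, u i = w i) := by
        intro hall; apply hne; funext i
        by_cases hi : i ∈ J
        · rw [← hall i hi]; simp [proj, hi]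
        · rw [hW] at hw; simp only [mem_filter, mem_univ, true_and] at hw; rw [hw i hi]; simp [proj, hi]
      rw [if_neg hdis, mul_zero]
    · intro hnot; exact absurd hmem hnot
  rw [key]
  refine Submodule.sum_mem _ fun w _ => Submodule.sum_mem _ fun r _ => Submodule.smul_mem _ _ ?_
  refine mul_mem_lowDeg_add (pattern_mem_lowDeg J w) ?_
  have := hasDegF_linTest (p := p) a r
  unfold HasDegF at this
  exact this

/-- **W-edge, kernel version: `WalkHardF p` ⟹ hardness against junta(`≤ log₂ n`) ⊕ one-form players**
(the node's `WalkHardFJLin p`, stated explicitly). -/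
theorem walkHardF_jlin (p : ℕ) [Fact p.Prime] (hW : WalkHardF p) :
    ∃ θ : ℝ, θ < 1 ∧ ∃ n₀ : ℕ, ∀ n ≥ n₀, ∀ c : ℕ, ∀ y : Fin (n + 1) → (Fin n → Bool) → Bool,
      (∀ g, ∃ J : Finset (Fin n), J.card ≤ Nat.log 2 n ∧ ∃ a : Fin n → ZMod p,
          ∃ h : (Fin n → Bool) → ZMod p → Bool,
          (∀ u v : Fin n → Bool, (∀ i ∈ J, u i = v i) → ∀ s, h u s = h v s) ∧
          ∀ u, y g u = h u (∑ i, if u i then a i else 0)) →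
      ((univ.filter fun u : Fin n → Bool => ringWinU c y u = true).card : ℝ) ≤ θ * (2 : ℝ) ^ n := by
  obtain ⟨θ, hθ, hC⟩ := hW
  obtain ⟨n₀, hn₀⟩ := hC 2
  have hp2 : 2 ≤ p := (Fact.out : p.Prime).two_le
  refine ⟨θ, hθ, max n₀ (2 ^ p), fun n hn c y hy => hn₀ n (le_trans (le_max_left _ _) hn) c y fun g => ?_⟩
  obtain ⟨J, hJc, a, h, hJ, hyg⟩ := hy g
  have hlog : p ≤ Nat.log 2 n := Nat.le_log_of_pow_le (by norm_num) (le_trans (le_max_right _ _) hn)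
  have hdeg := hasDegF_jlin J a h hJ (y g) hyg
  have hle : J.card + (p - 1) ≤ (Nat.log 2 n) ^ 2 := by
    have h1 : J.card + (p - 1) ≤ Nat.log 2 n + (Nat.log 2 n - 1) := by omega
    have h2 : Nat.log 2 n + (Nat.log 2 n - 1) ≤ Nat.log 2 n * Nat.log 2 n := by
      have hL : 2 ≤ Nat.log 2 n := le_trans hp2 hlog
      calc Nat.log 2 n + (Nat.log 2 n - 1) ≤ 2 * Nat.log 2 n := by omega
        _ ≤ Nat.log 2 n * Nat.log 2 n := Nat.mul_le_mul_right _ hL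
    rw [pow_two]; exact h1.trans h2
  unfold HasDegF at hdeg ⊢
  exact lowDeg_mono hle hdeg

end Summit.QuantumAdvantage.AdviceFreeQNC0
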